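import Summits.QuantumFields.BalabanUV.T4Continuum.Support.NE4TransferModel

/-!
# NE7EtaDataLipschitz — route #1 of the NE7 crux, hardest stub S1∕L7 DECOMPOSED at the level of row NE4's transfer model:
# `StepScaleShift` ⇐ (L7a) ONE-RUN DATA-LIPSCHITZ dependence of the one-step maps on their inputs × (L7b) the η-RATE OF THE DATA
# — the kernel form of ROUTES-NE7.md v1 §L1.2 «LIP» (lens 1, rank 2 → t4-ne7-p1): [Balaban1988RG2Cluster] p. 3 after (1.5),
# inputs as free variables

Cell `pub-balaban`, rung (B)+1 sub-cell t4, lineage `b2b-balaban-t4-ne7-p1` (node U5 = NE7; generation 20 = CRUX PROVER NE7 #1 under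
the coordinator ruling «YM REDIRECT» e34b3e0c), crux skeleton `HOME/t4/b2b-balaban-t4-ne7-p1-g20/ROUTE1-NE7.md` v1.2 §2 (stub S1, leaf L7),
ideation file `HOME/t4/ROUTES-NE7.md` v1 (t4-ne7-idea-1) §L1.2 route LIP «INPUT-CONVEXITY CAUCHY–LIPSCHITZ OF B13's STEP MAP» (rank 2,
addressed to this seat as SUPPLIER of route #1).  HONEST FRAMING (page 1): FIXED FINITE T⁴, rung (B)+1 = the `ε → 0` limit of unit-scale
averaged expectations, CONDITIONAL on BetaPertH and the nine spine estimates (0/9 proved); NOT infinite volume, NOT a mass gap, NOT the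
Clay problem.  NE7 and NE4 are NOT PRINTED in [Balaban1984PropagatorsI]–[Balaban1989LargeFieldII] and NOT proved here.

THE PRINTED LICENCE (quoted for CONTEXT — the manuscript is under audit; nothing of it is asserted): [Balaban1988RG2Cluster] (= [II], cell
paper B13, CMP 116) p. 3, after (1.5): «In these equations we can replace the propagators by arbitrary operators having the same regularity
properties and satisfying the same bounds.  Only these bounds were important in the analysis of Sect. C, E [15], hence the solutions D, A₀
can be considered as functional of these operators: D(A′) = D(H, A′), A₀ = A₀(H, G, H₀B′).»  Route LIP reads this as: the one-step maps
are functions of an INPUT TUPLE `in = (G_j, U_j, (E^{(i)})_{i<j}, g_j)` ranging over an admissible class, Lipschitz in the inputs (one Cauchy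
estimate in an interpolation parameter); then every η-rate the spine asks of the step (rows NE5, NE2∧NE3 inside L7) is «Lipschitz constant ×
η-rate of the inputs», and the history moduli (row NE9) are the old-term slots.  Row NE4's `StepTransferModel` (`Support/NE4TransferModel`)
already carries the old-term slot (`W`, L3 `TransferBound`), the activity slot (L4 `ActivityLipschitz`) and the coupling slot (L5
`CouplingLipschitz`); the DATA slot — through which the depth `k` (the fine spacing `L^{−k}`) enters — is hidden inside the primitive leaf L7
`StepScaleShift`.  This file makes the data slot explicit and proves the decomposition.

WHAT IS PROVED ([folklore]; hypothesis SHAPES over the model, displayed; no `def`).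
§1 **`stepScaleShift_of_dataLipschitz`** — let the model's maps FACTOR THROUGH DATA: `M.N k c a = Nh c (dat k) a`, `M.r k c a = rh c (dat k) a`,
   `M.W k c E = Wh k c (dat k) E` for a data sequence `dat : ℕ → 𝔇` in an admissible set `AdmD` of a normed group `𝔇` (the depth enters ONLY
   through `dat k`: «one step map, read at the data of depth k»), with (L7a) DATA-LIPSCHITZ bounds — `‖Nh c D a − Nh c D′ a′‖ ≤ C_N‖D − D′‖ +
   C_F‖a − a′‖`, the same for `rh` with `(C_r, C_r′)`, and `‖Wh k c D E − Wh k c D′ E‖ ≤ C_W‖D − D′‖` on admissible old data (ONE-RUN, printed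
   TYPE: the licence above + [II] Lemma 3 (2.38) p. 20 read for a difference; NOT PRINTED as a statement) —, the STRUCTURAL compatibility
   `Wh (k+1) c D (0 ∷ E) = Wh k c D E` (a silent empty oldest slot transfers nothing), and (L7b) the DATA η-RATE `‖dat (k+1) − dat k‖ ≤ b_D ρ^k`
   (TWO-RUN content: the inputs at relative spacings `L^{−k−1}` vs `L^{−k}`; flat coordinates = (CONV-C)-type statements, cf.
   `Support/NE7EtaCovarianceSlot` p247856 ∕ `Support/NE7EtaPropagatorSlot` p248034; background-dependent coordinates = rows NE2∕NE3).  THEN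
   `M.StepScaleShift ((C_N + C_F·C_W)·b_D) ((C_r + C_r′·C_W)·b_D) ρ E₀ γ`.
§2 `dataRate_prod` — the data η-rate of a PAIR of coordinates (sup norm) from the coordinates' rates: how slot-by-slot rates (§1's L7b for
   `𝔇 = 𝔇₁ × 𝔇₂ × …`) assemble; `dataRate_of_eq` — a coordinate that does not depend on the depth has rate `0`.
§3 `toy_dataLipschitz` — non-vacuity over `ℝ`: data `dat k = 2^{−k}`, `Nh c D a = D + a∕2`, `rh c D a = D`, `Wh = 0`; every hypothesis
   of §1 discharged, the data genuinely depth-dependent.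

HONEST STATUS.  A DECOMPOSITION of L7, not a discharge: (L7a) for Bałaban's step is ONE-RUN and printed-TYPE only (route LIP's audit P-LIP-1
— is every use of the inputs in [II] §§1–2 convex∕form-level? — decides whether it is ONE Cauchy estimate or a species-by-species recursion);
(L7b) for the background-dependent coordinates (minimisers `U_k(V)`, propagators at `U ≠ 1`) is rows NE2∕NE3's two-run content, NOT PRINTED;
the instance O1 (NODE O) is constructed by nobody.  NOT NE4, NOT NE7; spine 0/9 unchanged.
-/

noncomputable section

namespace Summit.QuantumFields.BalabanUV.T4Continuum.NE7EtaDataLipschitz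

open Summit.QuantumFields.BalabanUV.T4Continuum.NE4TransferModel (StepTransferModel)

variable {𝔅 𝔸 : Type*} [NormedAddCommGroup 𝔅] [NormedSpace ℝ 𝔅] [NormedAddCommGroup 𝔸] [NormedSpace ℝ 𝔸]
variable {𝔇 : Type*} [NormedAddCommGroup 𝔇]

/-! ## §1 L7 = (data-Lipschitz, one run) × (data η-rate, two runs) -/

/-- **`StepScaleShift` FROM DATA-LIPSCHITZ MAPS AND THE DATA'S η-RATE** (route LIP at the level of the transfer model).  If the model's
one-step maps factor through a data sequence `dat k ∈ AdmD` — `N k c a = Nh c (dat k) a`, `r k c a = rh c (dat k) a`, `W k c = Wh k c (dat k)` —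
with the data-Lipschitz bounds (L7a) on `Nh` (`C_N`, activity constant `C_F`), `rh` (`C_r`, `C_r′`) and `Wh` (`C_W`, on admissible old data
`‖E_j‖ ≤ E₀`), the silent-slot compatibility `Wh (k+1) c D (0 ∷ E) = Wh k c D E`, and the data η-rate (L7b) `‖dat (k+1) − dat k‖ ≤ b_D ρ^k`,
then `M.StepScaleShift ((C_N + C_F C_W) b_D) ((C_r + C_r′ C_W) b_D) ρ E₀ γ`. [folklore] -/
theorem stepScaleShift_of_dataLipschitz (M : StepTransferModel 𝔅 𝔸) (AdmD : Set 𝔇) (dat : ℕ → 𝔇)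
    (Nh : ℝ → 𝔇 → 𝔸 → 𝔅) (rh : ℝ → 𝔇 → 𝔸 → ℝ) (Wh : (k : ℕ) → ℝ → 𝔇 → (Fin k → 𝔅) → 𝔸)
    {γ E₀ C_N C_F C_r C_r' C_W b_D ρ : ℝ}
    (hN : ∀ k c a, M.N k c a = Nh c (dat k) a) (hr : ∀ k c a, M.r k c a = rh c (dat k) a)
    (hW : ∀ k c (E : Fin k → 𝔅), M.W k c E = Wh k c (dat k) E)
    (hdat : ∀ k, dat k ∈ AdmD)
    (hcompat : ∀ k c D (E : Fin k → 𝔅), D ∈ AdmD → Wh (k + 1) c D (Matrix.vecCons 0 E) = Wh k c D E)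
    (hLN : ∀ c (D D' : 𝔇) (a a' : 𝔸), 0 < c → c ≤ γ → D ∈ AdmD → D' ∈ AdmD →
      ‖Nh c D a - Nh c D' a'‖ ≤ C_N * ‖D - D'‖ + C_F * ‖a - a'‖)
    (hLr : ∀ c (D D' : 𝔇) (a a' : 𝔸), 0 < c → c ≤ γ → D ∈ AdmD → D' ∈ AdmD →
      |rh c D a - rh c D' a'| ≤ C_r * ‖D - D'‖ + C_r' * ‖a - a'‖)
    (hLW : ∀ k c (D D' : 𝔇) (E : Fin k → 𝔅), 0 < c → c ≤ γ → D ∈ AdmD → D' ∈ AdmD → (∀ j, ‖E j‖ ≤ E₀) →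
      ‖Wh k c D E - Wh k c D' E‖ ≤ C_W * ‖D - D'‖)
    (hDR : ∀ k, ‖dat (k + 1) - dat k‖ ≤ b_D * ρ ^ k)
    (hCN : 0 ≤ C_N) (hCF : 0 ≤ C_F) (hCr : 0 ≤ C_r) (hCr' : 0 ≤ C_r') (hCW : 0 ≤ C_W) :
    M.StepScaleShift ((C_N + C_F * C_W) * b_D) ((C_r + C_r' * C_W) * b_D) ρ E₀ γ := by
  intro k c E hc hcγ hE
  -- the two activities differ only through the data (silent slot)
  have hact : ‖M.W (k + 1) c (Matrix.vecCons 0 E) - M.W k c E‖ ≤ C_W * ‖dat (k + 1) - dat k‖ := by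
    rw [hW, hW, hcompat k c (dat (k + 1)) E (hdat (k + 1))]
    exact hLW k c (dat (k + 1)) (dat k) E hc hcγ (hdat (k + 1)) (hdat k) hE
  have hΔ := hDR k
  have hΔ0 : 0 ≤ ‖dat (k + 1) - dat k‖ := norm_nonneg _
  constructor
  · rw [hN, hN]
    calc ‖Nh c (dat (k + 1)) (M.W (k + 1) c (Matrix.vecCons 0 E)) - Nh c (dat k) (M.W k c E)‖
        ≤ C_N * ‖dat (k + 1) - dat k‖ + C_F * ‖M.W (k + 1) c (Matrix.vecCons 0 E) - M.W k c E‖ :=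
          hLN c _ _ _ _ hc hcγ (hdat (k + 1)) (hdat k)
      _ ≤ C_N * ‖dat (k + 1) - dat k‖ + C_F * (C_W * ‖dat (k + 1) - dat k‖) := by
          have := mul_le_mul_of_nonneg_left hact hCF
          linarith
      _ = (C_N + C_F * C_W) * ‖dat (k + 1) - dat k‖ := by ring
      _ ≤ (C_N + C_F * C_W) * (b_D * ρ ^ k) := mul_le_mul_of_nonneg_left hΔ (by positivity)
      _ = (C_N + C_F * C_W) * b_D * ρ ^ k := by ring
  · rw [hr, hr]
    calc |rh c (dat (k + 1)) (M.W (k + 1) c (Matrix.vecCons 0 E)) - rh c (dat k) (M.W k c E)|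
        ≤ C_r * ‖dat (k + 1) - dat k‖ + C_r' * ‖M.W (k + 1) c (Matrix.vecCons 0 E) - M.W k c E‖ :=
          hLr c _ _ _ _ hc hcγ (hdat (k + 1)) (hdat k)
      _ ≤ C_r * ‖dat (k + 1) - dat k‖ + C_r' * (C_W * ‖dat (k + 1) - dat k‖) := by
          have := mul_le_mul_of_nonneg_left hact hCr'
          linarith
      _ = (C_r + C_r' * C_W) * ‖dat (k + 1) - dat k‖ := by ring
      _ ≤ (C_r + C_r' * C_W) * (b_D * ρ ^ k) := mul_le_mul_of_nonneg_left hΔ (by positivity)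
      _ = (C_r + C_r' * C_W) * b_D * ρ ^ k := by ring

/-! ## §2 Assembling the data η-rate slot by slot -/

/-- **Slot-by-slot assembly**: for data with two coordinates (product, sup norm) the data η-rate follows from the coordinates' rates with
`b_D = max b₁ b₂` (and so on for more coordinates by iterating). [folklore] -/
theorem dataRate_prod {𝔇₁ 𝔇₂ : Type*} [NormedAddCommGroup 𝔇₁] [NormedAddCommGroup 𝔇₂] (d₁ : ℕ → 𝔇₁) (d₂ : ℕ → 𝔇₂)
    {b₁ b₂ ρ : ℝ} (hρ : 0 ≤ ρ) (h₁ : ∀ k, ‖d₁ (k + 1) - d₁ k‖ ≤ b₁ * ρ ^ k) (h₂ : ∀ k, ‖d₂ (k + 1) - d₂ k‖ ≤ b₂ * ρ ^ k) :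
    ∀ k, ‖((d₁ (k + 1), d₂ (k + 1)) : 𝔇₁ × 𝔇₂) - (d₁ k, d₂ k)‖ ≤ max b₁ b₂ * ρ ^ k := by
  intro k
  rw [Prod.mk_sub_mk, Prod.norm_def]
  refine max_le ?_ ?_
  · exact (h₁ k).trans (mul_le_mul_of_nonneg_right (le_max_left _ _) (pow_nonneg hρ _))
  · exact (h₂ k).trans (mul_le_mul_of_nonneg_right (le_max_right _ _) (pow_nonneg hρ _))

/-- A coordinate that does not depend on the depth has data η-rate `0`. [folklore] -/
theorem dataRate_of_eq {𝔇₁ : Type*} [NormedAddCommGroup 𝔇₁] (d : ℕ → 𝔇₁) (h : ∀ k, d (k + 1) = d k) (ρ : ℝ) :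
    ∀ k, ‖d (k + 1) - d k‖ ≤ 0 * ρ ^ k := fun k => by
  rw [h k, sub_self, norm_zero, zero_mul]

/-! ## §3 Non-vacuity over `ℝ` -/

/-- TOY: `𝔅 = 𝔸 = 𝔇 = ℝ`, data `dat k = 2^{−k}` (genuinely depth-dependent; rate `b_D = 1∕2`, `ρ = 1∕2`), `Nh c D a = D + a∕2`
(`C_N = 1`, `C_F = 1∕2`), `rh c D a = D` (`C_r = 1`, `C_r′ = 0`), transfer `Wh = 0` (compatibility trivial; `C_W = 1` admissible); every
hypothesis of §1 is discharged and the conclusion is `StepScaleShift ((1 + ½·1)·½) ((1 + 0·1)·½) ½ 1 1` for the displayed model. [folklore] -/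
theorem toy_dataLipschitz :
    ∃ M : StepTransferModel ℝ ℝ, M.StepScaleShift ((1 + 1 / 2 * 1) * (1 / 2)) ((1 + 0 * 1) * (1 / 2)) (1 / 2) 1 1 ∧
      (∀ k c a, M.N k c a = (1 / 2 : ℝ) ^ k + a / 2) := by
  refine ⟨{ W := fun k c => 0, N := fun k c a => (1 / 2 : ℝ) ^ k + a / 2, r := fun k c a => (1 / 2 : ℝ) ^ k, B := fun k w => 0 },
    ?_, fun k c a => rfl⟩
  have h := stepScaleShift_of_dataLipschitz (𝔅 := ℝ) (𝔸 := ℝ) (𝔇 := ℝ)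
    { W := fun k c => 0, N := fun k c a => (1 / 2 : ℝ) ^ k + a / 2, r := fun k c a => (1 / 2 : ℝ) ^ k, B := fun k w => 0 }
    Set.univ (fun k => (1 / 2 : ℝ) ^ k) (fun c D a => D + a / 2) (fun c D a => D) (fun k c D E => 0)
    (γ := 1) (E₀ := 1) (C_N := 1) (C_F := 1 / 2) (C_r := 1) (C_r' := 0) (C_W := 1) (b_D := 1 / 2) (ρ := 1 / 2)
    (fun k c a => rfl) (fun k c a => rfl) (fun k c E => by simp) (fun k => Set.mem_univ _)
    (fun k c D E _ => rfl)
    (fun c D D' a a' _ _ _ _ => by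
      rw [Real.norm_eq_abs, Real.norm_eq_abs, Real.norm_eq_abs]
      have : D + a / 2 - (D' + a' / 2) = (D - D') + (1 / 2) * (a - a') := by ring
      rw [this]
      calc |D - D' + 1 / 2 * (a - a')| ≤ |D - D'| + |1 / 2 * (a - a')| := abs_add_le _ _
        _ = 1 * |D - D'| + 1 / 2 * |a - a'| := by rw [abs_mul, abs_of_pos (by norm_num : (0:ℝ) < 1 / 2), one_mul])
    (fun c D D' a a' _ _ _ _ => by
      rw [Real.norm_eq_abs, Real.norm_eq_abs]; linarith [abs_nonneg (a - a')])
    (fun k c D D' E _ _ _ _ _ => by simp)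
    (fun k => by
      rw [Real.norm_eq_abs, pow_succ]
      have h0 : 0 ≤ (1 / 2 : ℝ) ^ k := by positivity
      rw [show (1 / 2 : ℝ) ^ k * (1 / 2) - (1 / 2) ^ k = -((1 / 2) * (1 / 2) ^ k) by ring, abs_neg,
        abs_of_nonneg (by positivity)])
    (by norm_num) (by norm_num) (by norm_num) le_rfl (by norm_num)
  exact h

end Summit.QuantumFields.BalabanUV.T4Continuum.NE7EtaDataLipschitz

end
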